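import Summits.QuantumFields.BalabanUV.T4Continuum.Support.ShellMeasureLandauWilsonSquares

/-!
# `T4Continuum.ShellMeasureLandauWilsonNonneg` — THE WILSON DENSITY IS NONNEGATIVE: S76 f2's binder `hWlb` for S74's
# DEFINED Wilson profile `𝓔_W y = Σ_{p∈P_w} β·(1 − Re tr(B_p·holOf (ℓw p) Z y)∕N)` at real chart points
(cell `pub-balaban`, sub-cell `t4`, spine estimate NE7c (node U5b); NE7c ROUND-2 crew, unit
`b2b-balaban-t4-ne7c-formalise-leaf-01` gen 7 (S70∕S79 holder lineage), own-initiative companion of rows S74 (leaf-09-g11)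
and S76 f2 (leaf-04-g6), INTENT journal l.17635 (from XREAD INFO 1 of C-ne7cleaf01g7-2); ADDITIVE — imports S74 f1
`ShellMeasureLandauWilsonSquares` (p225819: `listProd_exp_mem_unitary`; hence the LD chain's (A)
`ShellMeasureLandauHolonomyReal.landauField_mem_real`, `ShellMeasureLandauHolonomyChart.holOf`, `ShellMeasureWilsonWords.wordExp`)
ONLY; [folklore]; 0 `def`, 0 `def … : Prop`, 0 sorry, 0 citations)

HONEST FRAMING.  Finite four-torus programme, rung (B)+1 only — NOT infinite volume, NOT a mass gap, NOT the Clay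
problem, NOT summit progress; (B), `BetaPertHyp`, (B^μ) not consumed.  NE7c (`T4IndicatorShell.ShellWeightBound`) is NOT
PRINTED in [Balaban 1983–89] and NOT PROVED; «NE7c ⇐ the named binders» (trigger c3).  Nothing printed is asserted; no
estimate of Bałaban's is discharged; this file is LINEAR ALGEBRA (a unitary matrix has `Re tr ≤ N`) on OUR side.
HONEST DEPENDENCY (cell): continuum YM on T⁴ ⇐ BetaPertH ∧ nine spine estimates (0/9 proved); BetaPertH ⇐ (D1) ∧ (D4) ∧
CAP+tail; G-an2-4 gates asym, D1 and NE2/3/4.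

THE POINT.  The live-level END of record with two 𝓔-slots, S76 f2 `ShellMeasureLandauEndFinal.slotAC_realized_su2_landauChart
_final` (p227065), carries the binder `hWlb : ∀ V y, ‖y‖ ≤ S → 0 ≤ 𝓔W V y` (it feeds `hfin` through the lower bound of
the total exponent).  For the Wilson supplier S74 (`ShellMeasureLandauWilsonSquares.hE_landau_wilsonSquares` ∕ f2
`…_pinned`) the profile is DEFINED: `𝓔_W y = Σ_{p∈P_w} β·(1 − Re tr(B_p · holOf (ℓw p) Z y)∕N)` with the LD chain's real
exponent field `Z`, FROZEN UNITARY prefactors `B_p` (owner N-ne7cp1-g31-2) and SKEW weight read-outs — and for it `hWlb`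
is a THEOREM, proved here:
* §1 (`M_N(ℂ)`): `re_trace_le_card_of_mem_unitary` (`U ∈ unitary ⟹ (tr U).re ≤ N`, Mathlib `entry_norm_bound_of_unitary`),
  `wilsonDensity_nonneg` (`β ≥ 0 ⟹ 0 ≤ β·(1 − (tr U).re∕N)`), `wordExp_mem_unitary_of_skew`, `sum_wilsonDensity_nonneg`
  (frozen unitary prefactor × a word of exponentials of skew letters);
* §2 **`hWlb_landau_wilsonSquares`** — S76 f2's `hWlb` LITERALLY for S74 §4's defined profile: at every real chart
  point `‖y‖ ≤ S` the exponent `Z y` is REAL (LD (A) `landauField_mem_real`, binders by name), the weight letters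
  `ℓ (Z y)` are skew (`hskew`), the word is unitary (S74 f1 `listProd_exp_mem_unitary`), so every summand is `≥ 0`.
NOT HERE: the `hE` pair itself (S74), the non-Wilson lower bound `hElb` (S71 f2 ∕ S78 suppliers), the assembly (S76's
holder).  NOTHING in the countdown moves; NE7c NOT PROVED; spine PROVED 0∕9.
-/

noncomputable section

open Set Metric NormedSpace
open scoped Matrix.Norms.L2Operator

namespace Summit.QuantumFields.BalabanUV.T4Continuum.ShellMeasureLandauWilsonNonneg

open Literature.MathematicalPhysics.QuantumFieldTheory.Balaban1983to89
open B11Prop6Scheme (Prop4Hyp)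
open Summit.QuantumFields.BalabanUV.T4Continuum.ShellMeasureWilsonWords (wordExp)
open Summit.QuantumFields.BalabanUV.T4Continuum.ShellMeasureLandauHolonomy (solAt landauExp)
open Summit.QuantumFields.BalabanUV.T4Continuum.ShellMeasureLandauHolonomyChart (holOf holOf_apply cplx)
open Summit.QuantumFields.BalabanUV.T4Continuum.ShellMeasureLandauHolonomyReal (landauField_mem_real)
open Summit.QuantumFields.BalabanUV.T4Continuum.ShellMeasureLandauWilsonSquares (listProd_exp_mem_unitary)

/-! ## §1 `M_N(ℂ)`: a unitary matrix has `Re tr ≤ N`; the Wilson density is nonnegative -/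

section Unitary

variable {n : Type*} [Fintype n] [DecidableEq n]

/-- **`Re tr U ≤ N` FOR UNITARY `U`**: every entry of a unitary matrix has norm `≤ 1` (Mathlib
`entry_norm_bound_of_unitary`), so `(tr U).re = Σ_i Re U_ii ≤ Σ_i ‖U_ii‖ ≤ card n`. [folklore] -/
theorem re_trace_le_card_of_mem_unitary {U : Matrix n n ℂ} (hU : U ∈ unitary (Matrix n n ℂ)) :
    (Matrix.trace U).re ≤ Fintype.card n := by
  rw [Matrix.trace, Complex.re_sum]
  calc ∑ i, (Matrix.diag U i).re ≤ ∑ _i : n, (1 : ℝ) := Finset.sum_le_sum fun i _ => by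
        rw [Matrix.diag_apply]
        exact (Complex.re_le_norm _).trans (entry_norm_bound_of_unitary hU i i)
    _ = Fintype.card n := by simp

/-- **THE WILSON DENSITY OF A UNITARY PLAQUETTE VARIABLE IS NONNEGATIVE**: `β ≥ 0`, `U` unitary ⟹
`0 ≤ β·(1 − (tr U).re∕card n)`. [folklore] -/
theorem wilsonDensity_nonneg [Nonempty n] {U : Matrix n n ℂ} (hU : U ∈ unitary (Matrix n n ℂ)) {β : ℝ}
    (hβ : 0 ≤ β) : 0 ≤ β * (1 - (Matrix.trace U).re / Fintype.card n) := by
  have hN : (0 : ℝ) < Fintype.card n := by exact_mod_cast Fintype.card_pos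
  refine mul_nonneg hβ (sub_nonneg.2 ?_)
  rw [div_le_one hN]
  exact re_trace_le_card_of_mem_unitary hU

/-- A word of exponentials of SKEW-ADJOINT letters is unitary (S74 f1 `listProd_exp_mem_unitary` in the `wordExp`
spelling of `ShellMeasureWilsonWords`). [folklore] -/
theorem wordExp_mem_unitary_of_skew {l : List (Matrix n n ℂ)} (h : ∀ Y ∈ l, Y ∈ skewAdjoint (Matrix n n ℂ)) :
    wordExp l ∈ unitary (Matrix n n ℂ) := by
  rw [wordExp]
  exact listProd_exp_mem_unitary l h

/-- **THE SECTIONED WILSON PART IS NONNEGATIVE**: frozen unitary prefactors `B_p` and words `W_p` of exponentials of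
skew letters, `β ≥ 0` ⟹ `0 ≤ Σ_{p∈P_w} β·(1 − Re tr(B_p·W_p)∕N)`. [folklore] -/
theorem sum_wilsonDensity_nonneg [Nonempty n] {𝔭 : Type*} (Pw : Finset 𝔭) (Bp : 𝔭 → Matrix n n ℂ)
    (ls : 𝔭 → List (Matrix n n ℂ)) (hBu : ∀ p ∈ Pw, Bp p ∈ unitary (Matrix n n ℂ))
    (hskew : ∀ p ∈ Pw, ∀ Y ∈ ls p, Y ∈ skewAdjoint (Matrix n n ℂ)) {β : ℝ} (hβ : 0 ≤ β) :
    0 ≤ ∑ p ∈ Pw, β * (1 - (Matrix.trace (Bp p * wordExp (ls p))).re / Fintype.card n) :=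
  Finset.sum_nonneg fun p hp =>
    wilsonDensity_nonneg ((unitary (Matrix n n ℂ)).mul_mem (hBu p hp) (wordExp_mem_unitary_of_skew (hskew p hp))) hβ

end Unitary

/-! ## §2 S76 f2's `hWlb` for S74's defined Wilson profile on the LD chain -/

section ChartRay

variable {nM : Type*} [Fintype nM] [DecidableEq nM] [Nonempty nM]
variable {𝒴 𝒴' 𝒳 𝒵 ℬ : Type*} [NormedAddCommGroup 𝒴] [NormedSpace ℂ 𝒴] [CompleteSpace 𝒴]
  [NormedAddCommGroup 𝒴'] [NormedSpace ℂ 𝒴'] [NormedAddCommGroup 𝒳] [NormedSpace ℂ 𝒳] [CompleteSpace 𝒳]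
  [NormedAddCommGroup 𝒵] [NormedSpace ℂ 𝒵] [NormedAddCommGroup ℬ] [NormedSpace ℂ ℬ]
variable {n : ℕ} {𝒢 : 𝒵 →L[ℂ] 𝒴} {W𝒱 : 𝒴 → 𝒵} {B₀ C₄ a₃ : ℝ}

/-- **S76 f2's `hWlb` FOR S74's DEFINED WILSON PROFILE — A THEOREM, NOT A BINDER.**  Binders: the subset of S74 §4
`hE_landau_wilsonSquares`'s used by LD (A) `landauField_mem_real` (scheme data (P2) `h𝒢`, (P4) `hW`, (118)∕(121),
(103) `hH₁`, (75) `hΦ`, `S < r_Φ`, (44) `hCq`∕`hCd`, scaling `hι`, (46) `hH`, (54)-smallness; the real structure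
`𝓡𝒴 … hΦr`) + the weight read-outs `ℓw` SKEW on real exponents (`hskew`, chain (E)) + FROZEN UNITARY prefactors `B_p`
(N-ne7cp1-g31-2) + `0 ≤ β`.  CONCLUSION — LITERALLY the shape of S76 f2's `hWlb` at S74 §4's profile:
`∀ y, ‖y‖ ≤ S → 0 ≤ Σ_{p∈P_w} β·(1 − Re tr(B_p · holOf (ℓw p) Z y)∕N)`,
`Z y = landauExp C ι H (4C₂(ε₄+B₀b)²) (solAt 𝒢 0 W𝒱 ε₄ 0 (H₁ Φ(cplx y)) + H₁ Φ(cplx y))`.  Equation numbers LOCATE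
shapes, not citations; nothing of Bałaban's discharged. [folklore] -/
theorem hWlb_landau_wilsonSquares {𝔭 : Type*} {Pw : Finset 𝔭} {S : ℝ}
    (h𝒢 : ∀ f, ‖𝒢 f‖ ≤ B₀ * ‖f‖) (hW : Prop4Hyp W𝒱 C₄ a₃) (hB₀ : 0 < B₀) (hC₄ : 0 ≤ C₄)
    {b ε₄ : ℝ} (hε₄ : 0 ≤ ε₄) (hdom : 2 * (ε₄ + B₀ * b) ≤ a₃)
    (hself : B₀ * C₄ * (ε₄ + B₀ * b) ^ 2 ≤ ε₄) (hcontr : 4 * B₀ * C₄ * (ε₄ + B₀ * b) < 1)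
    (H₁ : ℬ →L[ℂ] 𝒴) (hH₁ : ∀ B, ‖H₁ B‖ ≤ B₀ * ‖B‖)
    {Φ : (Fin n → ℂ) → ℬ} {rΦ : ℝ} (hΦ : ∀ z ∈ ball (0 : Fin n → ℂ) rΦ, ‖Φ z‖ < b) (hSr : S < rΦ)
    {C : 𝒴' → 𝒳} {C₂ R : ℝ} (hC₂ : 0 ≤ C₂) (hCq : ∀ Z : 𝒴', ‖Z‖ < R → ‖C Z‖ ≤ C₂ * ‖Z‖ ^ 2)
    (hCd : DifferentiableOn ℂ C (ball 0 R)) (ι : 𝒴 →L[ℂ] 𝒴') (hι : ∀ Y, ‖ι Y‖ ≤ ‖Y‖) (H : 𝒳 →L[ℂ] 𝒴)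
    (hH : ∀ X, ‖H X‖ ≤ B₀ * ‖X‖) (hq : 9 * C₂ * B₀ * (ε₄ + B₀ * b) < 1) (hRC : 3 * (ε₄ + B₀ * b) ≤ R)
    (ℓw : 𝔭 → List (𝒴 →L[ℂ] Matrix nM nM ℂ))
    -- the real structure (chain (A)) with SKEW weight read-outs (chain (E))
    (𝓡𝒴 : AddSubgroup 𝒴) (h𝓡𝒴 : IsClosed (𝓡𝒴 : Set 𝒴)) (𝓡𝒵 : AddSubgroup 𝒵) (𝓡𝒴' : AddSubgroup 𝒴')
    (𝓡𝒳 : AddSubgroup 𝒳) (h𝓡𝒳 : IsClosed (𝓡𝒳 : Set 𝒳)) (𝓡ℬ : AddSubgroup ℬ)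
    (h𝒢r : ∀ f ∈ 𝓡𝒵, 𝒢 f ∈ 𝓡𝒴) (hWr : ∀ Y ∈ 𝓡𝒴, W𝒱 Y ∈ 𝓡𝒵) (hιr : ∀ Y ∈ 𝓡𝒴, ι Y ∈ 𝓡𝒴')
    (hHr : ∀ X ∈ 𝓡𝒳, H X ∈ 𝓡𝒴) (hCr : ∀ Z ∈ 𝓡𝒴', C Z ∈ 𝓡𝒳) (hH₁r : ∀ B ∈ 𝓡ℬ, H₁ B ∈ 𝓡𝒴)
    (hΦr : ∀ y : Fin n → ℝ, ‖y‖ ≤ S → Φ (cplx y) ∈ 𝓡ℬ)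
    (hskew : ∀ p ∈ Pw, ∀ ℓ ∈ ℓw p, ∀ Y ∈ 𝓡𝒴, ℓ Y ∈ skewAdjoint (Matrix nM nM ℂ))
    -- the frozen background plaquettes at the chart centre: unitary (N-ne7cp1-g31-2); the sign of the coupling
    (Bp : 𝔭 → Matrix nM nM ℂ) (hBu : ∀ p ∈ Pw, Bp p ∈ unitary (Matrix nM nM ℂ)) {β : ℝ} (hβ : 0 ≤ β) :
    ∀ y : Fin n → ℝ, ‖y‖ ≤ S →
      0 ≤ ∑ p ∈ Pw, β * (1 - (Matrix.trace (Bp p * holOf (ℓw p) (fun y => landauExp C ι H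
        (4 * C₂ * (ε₄ + B₀ * b) ^ 2) (solAt 𝒢 0 W𝒱 ε₄ (0 : 𝒵) (H₁ (Φ (cplx y))) + H₁ (Φ (cplx y)))) y)).re /
          Fintype.card nM) := by
  intro y hy
  -- the exponent at the real chart point is REAL (LD (A))
  have hmem := landauField_mem_real h𝒢 hW hB₀ hC₄ hε₄ hdom hself hcontr H₁ hH₁ hΦ hSr hC₂ hCq hCd ι hι H hH hq hRC
    𝓡𝒴 h𝓡𝒴 𝓡𝒵 𝓡𝒴' 𝓡𝒳 h𝓡𝒳 𝓡ℬ h𝒢r hWr hιr hHr hCr hH₁r hΦr hy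
  -- each summand: frozen unitary prefactor × word of exponentials of SKEW letters ⟹ unitary ⟹ density ≥ 0
  refine Finset.sum_nonneg fun p hp => ?_
  rw [holOf_apply]
  refine wilsonDensity_nonneg ((unitary (Matrix nM nM ℂ)).mul_mem (hBu p hp)
    (wordExp_mem_unitary_of_skew fun Y hY => ?_)) hβ
  obtain ⟨ℓ, hℓ, rfl⟩ := List.mem_map.1 hY
  exact hskew p hp ℓ hℓ _ hmem

end ChartRay

end Summit.QuantumFields.BalabanUV.T4Continuum.ShellMeasureLandauWilsonNonneg

end
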